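import Summits.QuantumFields.BalabanUV.Beta.EriceFlowEnclosureB12AsPrintedHistoryContagionShiftFlowPicardFunctional
import Summits.QuantumFields.BalabanUV.Beta.EriceFlowEnclosureB12AsPrintedHistoryContagionShiftFlowPicardEnd

/-!
# Beta / EriceFlowEnclosureB12AsPrintedHistoryContagionShiftFlowPicardRate — ASYMPTOTIC FREEDOM IS CONTAGIOUS, part 21: THE SCALE-UNIFORM GEOMETRIC RATE OF NODE U2's
# ITERATION.  Part 13 bounded `|iterate B e (n+1) q − solution B e q|` by `(32C_mγe³∕(1−θ)²)(2∕(1+θ))^q 2^{−n}` — geometric in n but with a weight growing in the scale q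
# (the θ₁-weighted contraction).  Part 16's linear-weight kernel run along ONE iteration (`abs_picardIter_sub_le_uniform`) removes the weight: from the FIRST iterate on
# (which already carries the quarter profile, part 12) the chart distance to the solution grows at most linearly with slope `C_mγ∕(1−θ)` (node U2's
# `abs_drive_sub_drive_le`), so **`|iterate B e (n+1) q − solution B e q| ≤ 8e(e² + 1∕β*)·(C_mγ∕(1−θ))·4^{−n}` UNIFORMLY IN q** under the extra smallness
# `C_m(8e³ + 16e∕β*) ≤ (1−θ)²∕4` — node U2's `abs_iterate_sub_solution_le` (`γqⁿ∕(1−q)`, scale-uniform, under the floor) floor-free AND scale-uniform near zero pin.  On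
# the as-printed carrier (§26): the continuum running coupling of [I] Theorem 2's «g₀(ε, g)» is computed by node U2's Picard iteration from the constant history to
# accuracy `K·g·4^{−n}` SIMULTANEOUSLY AT ALL PHYSICAL SCALES (β-flow team, prover 1, unit `b2b-balaban-beta-bflow-p1`, gen 37; ROW AP-I·Uc × NODE U2)

HONEST FRAMING (page 1 of everything the β sub-cell writes): discharging `BetaPertH` makes Bałaban's UV stability UNCONDITIONAL — a
real constructive-QFT result; it is NOT the continuum limit and NOT the Clay problem.  HONEST DEPENDENCY (cell reorg 2026-08-19,
verbatim): «continuum YM on T⁴ ⇐ BetaPertH ∧ nine spine estimates (0/9 proved); BetaPertH ⇐ (D1) ∧ (D4) ∧ CAP+tail; G-an2-4 gates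
asym, D1 and NE2/3/4.»  THIS MODULE DISCHARGES NOTHING: a junction BY NAME of part 16 (`abs_picardIter_sub_le_uniform`), part 13 (`memFlow_solution_of_reference`,
`iterate_eq_picardIter`), part 12 (`picard_mem_of_envelope`, `invSq_picard`, `base_lower_of_envelope`), node U2's `T4BetaFlowWellPosed.abs_drive_sub_drive_le` and, on the carrier,
part 15 (`reference_of_typedTheorem2`, `solution_eq_gstar_of_typedTheorem2`) and part 11 (`flow_threshold_exists`), over node U2's HYPOTHESIS SHAPES and the NAMED FIELDS of
`B12BetaAsPrinted` ([I] = T. Bałaban, Commun. Math. Phys. **109** (1987) [Balaban1987RG1]; `Theorem2Statement` STATED WITHOUT PROOF, p. 259 — a HYPOTHESIS; NE4 ∕ moduli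
LETTERS NOT PRINTED, GAPS G-t4-U2-1 ∕ -2).  Nothing of Bałaban's β is asserted; nothing of node U2's modules is restated or modified.

WHAT THIS FILE PROVES (0 sorry, 0 def): §25 **`abs_iterate_sub_solution_le_uniform`**; §26 **`gstar_picard_rate_uniform_of_typedTheorem2`**.  NOT CLAIMED: anything about
Bałaban's β; optimal constants; `BetaPertH`; the continuum limit of the measures; Clay.
-/

namespace Summit.QuantumFields.BalabanUV.Beta.EriceFlowEnclosureB12AsPrintedHistoryContagionShiftFlowPicardRate

open Finset Filter Topology
open Literature.MathematicalPhysics.QuantumFieldTheory.Balaban1983to89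
open Literature.MathematicalPhysics.QuantumFieldTheory.Balaban1983to89.B12BetaAsPrinted
open Literature.MathematicalPhysics.QuantumFieldTheory.Balaban1983to89.FlowStep (RGEqH)
open Literature.MathematicalPhysics.QuantumFieldTheory.Balaban1983to89.T4CouplingMatching (HistLipschitz FadingMemory ScaleShiftRate)
open Literature.MathematicalPhysics.QuantumFieldTheory.Balaban1983to89.T4ContinuumCoupling (gstar)
open Literature.MathematicalPhysics.QuantumFieldTheory.Balaban1983to89.T4BetaStationary (SeqBox MemoryProfile betaInf memoryProfile_betaInf abs_sub_le_of_seqBox)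
open Literature.MathematicalPhysics.QuantumFieldTheory.Balaban1983to89.T4BetaFlowWellPosed (MemFlow drive picard iterate solution invSq_eq_of_memFlow
  abs_drive_sub_drive_le)
open Summit.QuantumFields.BalabanUV.Beta.EriceFlowEnclosureB12AsPrintedHistoryContagionShiftFlowEnd (flow_threshold_exists)
open Summit.QuantumFields.BalabanUV.Beta.EriceFlowEnclosureB12AsPrintedHistoryContagionShiftFlowPicard (picard_mem_of_envelope invSq_picard base_lower_of_envelope)
open Summit.QuantumFields.BalabanUV.Beta.EriceFlowEnclosureB12AsPrintedHistoryContagionShiftFlowPicardLimit (memFlow_solution_of_reference iterate_eq_picardIter)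
open Summit.QuantumFields.BalabanUV.Beta.EriceFlowEnclosureB12AsPrintedHistoryContagionShiftFlowPicardEnd (reference_of_typedTheorem2 solution_eq_gstar_of_typedTheorem2)
open Summit.QuantumFields.BalabanUV.Beta.EriceFlowEnclosureB12AsPrintedHistoryContagionShiftFlowPicardFunctional (abs_picardIter_sub_le_uniform)

noncomputable section

/-! ## §25 Node U2's iterates from the constant history converge at a scale-uniform geometric rate -/

/-- **SCALE-UNIFORM GEOMETRIC RATE FOR NODE U2's `iterate`.**  `B` with memory profile `MemoryProfile C_m θ γ B` (0 ≤ θ < 1, C_m ≥ 0); ONE box solution t of `MemFlow B g* t`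
with the AF profile `1∕t_a² + β*·m ≤ 1∕t(m)²`; a pin `0 < e`, `2e ≤ γ` with `4C_m e ≤ β*(1 − θ)`, `e²·(1∕g*² + C_mγ∕(1 − θ)² + (2C_m∕((1 − θ)β*))²) ≤ 3∕4`, `64C_m e³ ≤ (1 − θ)²` and
`C_m(8e³ + 16e∕β*) ≤ (1 − θ)²∕4`.  THEN for all n and ALL scales q: **`|iterate B e (n+1) q − solution B e q| ≤ 8e(e² + 1∕β*)·(C_mγ∕(1−θ))·4^{−n}`** — the first iterate
`picard B e (e, e, …)` carries the quarter profile (part 12) and its chart distance to the solution is `≤ (C_mγ∕(1−θ))·q` (node U2's `abs_drive_sub_drive_le`), and part 16's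
kernel contracts it by ¼ per step uniformly in the scale. [cite: Balaban1987RG1, Thm 2 (0.31) p.259 with (0.20) p.256 and p.298] -/
theorem abs_iterate_sub_solution_le_uniform {B : (ℕ → ℝ) → ℝ} {Cm θ γ bs ta gs e : ℝ} {t : ℕ → ℝ}
    (hB : MemoryProfile Cm θ γ B) (hCm : 0 ≤ Cm) (hθ0 : 0 ≤ θ) (hθ1 : θ < 1) (hbs : 0 < bs) (hta : 0 < ta)
    (hts : SeqBox γ t) (htf : MemFlow B gs t) (hprof : ∀ m : ℕ, 1 / ta ^ 2 + bs * (m : ℝ) ≤ 1 / (t m) ^ 2)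
    (he : 0 < e) (h2e : 2 * e ≤ γ)
    (hs1 : 4 * Cm * e ≤ bs * (1 - θ))
    (hs2 : e ^ 2 * (1 / gs ^ 2 + Cm * γ / (1 - θ) ^ 2 + (2 * Cm / ((1 - θ) * bs)) ^ 2) ≤ 3 / 4)
    (hs4 : 64 * Cm * e ^ 3 ≤ (1 - θ) ^ 2) (hs6 : Cm * (8 * e ^ 3 + 16 * e / bs) ≤ (1 - θ) ^ 2 / 4) (n q : ℕ) :
    |iterate B e (n + 1) q - solution B e q| ≤ 8 * e * (e ^ 2 + 1 / bs) * (Cm * (γ / (1 - θ))) * (1 / 4) ^ n := by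
  have h1θ : 0 < 1 - θ := by linarith
  have hγ : 0 ≤ γ := by linarith
  have hus : SeqBox γ (fun _ : ℕ => e) := fun _ => ⟨he, by linarith⟩
  have henv : ∀ q : ℕ, (fun _ : ℕ => e) q ≤ 2 * e := fun _ => by simp only; linarith
  -- the first iterate: box-valued, ≤ 2e, quarter profile
  obtain ⟨hu1s, hu1prof, hu1env⟩ := picard_mem_of_envelope hB hCm hθ0 hθ1 hbs hta hts htf hprof he h2e hus henv hs1 hs2
  -- the solution
  obtain ⟨hss, hsf, hsprof, -⟩ := memFlow_solution_of_reference hB hCm hθ0 hθ1 hbs hta hts htf hprof he h2e hs1 hs2 hs4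
  -- chart distance of the first iterate to the solution: linear with slope C_mγ∕(1−θ)
  have hN0 : ∀ q : ℕ, |1 / (picard B e (fun _ : ℕ => e) q) ^ 2 - 1 / (solution B e q) ^ 2| ≤ Cm * (γ / (1 - θ)) * ((q : ℝ) + 1) := by
    intro q
    have hbase := base_lower_of_envelope hB hCm hθ0 hθ1 hbs hta hts htf hprof he hus henv hs1 hs2 q
    have hS : 0 < 1 / e ^ 2 + drive B (fun _ : ℕ => e) q := (by positivity : (0 : ℝ) < 1 / (4 * e ^ 2) + bs / 4 * (q : ℝ)).trans_le hbase
    rw [invSq_picard hS, invSq_eq_of_memFlow hsf q, add_sub_add_left_eq_sub]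
    have h := abs_drive_sub_drive_le (B' := B) (η := 0) hB hCm hθ0 hθ1 (fun v _ => by simp) hus hss (D := γ) (fun i => abs_sub_le_of_seqBox hus hss i) q
    rw [add_zero] at h
    have hK : 0 ≤ Cm * (γ / (1 - θ)) := by positivity
    calc |drive B (fun _ : ℕ => e) q - drive B (solution B e) q| ≤ (q : ℝ) * (Cm * (γ / (1 - θ))) := h
      _ ≤ Cm * (γ / (1 - θ)) * ((q : ℝ) + 1) := by nlinarith
  have hmain := abs_picardIter_sub_le_uniform hB hCm hθ0 hθ1 hbs hta hts htf hprof he h2e hu1s hu1env hu1prof hs1 hs2 hs6 hss hsf hsprof hN0 n q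
  -- `(picard B e)^[n] (picard B e (e,e,…)) = iterate B e (n+1)`
  have e1 : (picard B e)^[n] (picard B e (fun _ : ℕ => e)) = iterate B e (n + 1) := by
    rw [iterate_eq_picardIter, Function.iterate_succ_apply]
  rw [e1] at hmain
  calc |iterate B e (n + 1) q - solution B e q| ≤ 8 * e * (e ^ 2 + 1 / bs) * (Cm * (γ / (1 - θ))) * (1 / 4) ^ n := hmain

/-! ## §26 On the carrier: Theorem 2's continuum running coupling computed at a scale-uniform geometric rate -/

variable {S : Setting}

/-- **THE CONTINUUM RUNNING COUPLING OF THEOREM 2 IS COMPUTED BY NODE U2's PICARD ITERATION TO ACCURACY `K·g·4^{−n}` AT ALL PHYSICAL SCALES AT ONCE.**  `Theorem2Statement S hL`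
(a HYPOTHESIS) + the binder `hrg` on ]0, γ_u] + NE4 `ScaleShiftRate c θ γ_u S.β` + `HistLipschitz Λ γ_u S.β` with `FadingMemory C θ Λ` (0 < θ < 1, C ≥ 0, c ≥ 0) ⟹ for every torus
exponent m there are g₁₅ > 0 and K ≥ 0 such that for every g ∈ ]0, g₁₅], every family of Theorem-2-type rows in ]0, γ_u] pinned at g, all n and ALL physical scales m′:
`|iterate (betaInf S.β) g (n+1) m′ − gstar rows m′| ≤ K·g·4^{−n}` (K = 8(g₁₅² + 1∕b)·Cγ_u∕(1−θ) from the reference's rate b).  Part 15's `gstar_picard_rate_of_typedTheorem2`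
without the scale weight `(2∕(1+θ))^{m′}`. [cite: Balaban1987RG1, Thm 2 (0.31) p.259 with (0.20) p.256 and §5 p.298] -/
theorem gstar_picard_rate_uniform_of_typedTheorem2 {hL : Odd S.L ∧ 1 < S.L} (h : Theorem2Statement S hL)
    {γu θ C c : ℝ} {Λ : ℕ → ℕ → ℝ} (hγu : 0 < γu)
    (hrg : ∀ P : B12.RunParams, Step.InInterval γu P.K (S.cpl P) → RGEqH P.K S.β (S.cpl P))
    (hS : ScaleShiftRate c θ γu S.β) (hL' : HistLipschitz Λ γu S.β) (hΛ : FadingMemory C θ Λ)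
    (hθ0 : 0 < θ) (hθ1 : θ < 1) (hC : 0 ≤ C) (hc : 0 ≤ c) (m : ℕ) :
    ∃ g₁₅ K : ℝ, 0 < g₁₅ ∧ 0 ≤ K ∧ ∀ (e : ℝ) (g : ℕ → ℕ → ℝ), 0 < e → e ≤ g₁₅ →
      (∀ K', ∃ (m' : ℕ) (g₀ : ℝ), g K' = S.cpl ⟨K', m', g₀⟩) → (∀ K', Step.InInterval γu K' (g K')) → (∀ K', g K' K' = e) →
      ∀ n m' : ℕ, |iterate (betaInf S.β) e (n + 1) m' - gstar g m'| ≤ K * e * (1 / 4) ^ n := by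
  have h1θ : 0 < 1 - θ := by linarith
  have hB := memoryProfile_betaInf hS hL' hΛ hθ0.le hθ1
  obtain ⟨gr, b, -, -, t, hgr, hb, -, -, htbox, htflow, hprof, -, -⟩ := reference_of_typedTheorem2 h hγu hrg hS hL' hΛ hθ0 hθ1 hC hc m
  have h2gr : 0 < 2 * gr := by positivity
  obtain ⟨e₀, he₀, hthr⟩ := flow_threshold_exists (1 / gr ^ 2 + C * γu / (1 - θ) ^ 2 + (2 * C / ((1 - θ) * b)) ^ 2) hC hθ1 hb
  obtain ⟨g₉, hg₉, hsol⟩ := solution_eq_gstar_of_typedTheorem2 h hγu hrg hS hL' hΛ hθ0 hθ1 hC hc m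
  -- the extra smallness `C(8e³ + 16e∕b) ≤ (1−θ)²∕4` below e₁
  set e₁ : ℝ := min 1 ((1 - θ) ^ 2 / (4 * (C * (8 + 16 / b)) + 1)) with he₁
  have he₁0 : 0 < e₁ := lt_min one_pos (by positivity)
  have hs6 : ∀ e : ℝ, 0 < e → e ≤ e₁ → C * (8 * e ^ 3 + 16 * e / b) ≤ (1 - θ) ^ 2 / 4 := by
    intro e he hle
    have hle1 : e ≤ 1 := hle.trans (min_le_left _ _)
    have hle' : e ≤ (1 - θ) ^ 2 / (4 * (C * (8 + 16 / b)) + 1) := hle.trans (min_le_right _ _)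
    rw [le_div_iff₀ (by positivity)] at hle'
    have he3 : e ^ 3 ≤ e := by nlinarith [mul_le_mul hle1 hle1 he.le zero_le_one]
    have hK : 0 ≤ C * (8 + 16 / b) := by positivity
    calc C * (8 * e ^ 3 + 16 * e / b) ≤ C * (8 * e + 16 * e / b) := by gcongr
      _ = e * (C * (8 + 16 / b)) := by ring
      _ ≤ (1 - θ) ^ 2 / 4 := by nlinarith
  set g₁₅ : ℝ := min (min e₀ e₁) (min (γu / 2) g₉) with hg₁₅
  have hg₁₅0 : 0 < g₁₅ := lt_min (lt_min he₀ he₁0) (lt_min (by positivity) hg₉)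
  refine ⟨g₁₅, 8 * (g₁₅ ^ 2 + 1 / b) * (C * (γu / (1 - θ))), hg₁₅0, by positivity, fun e g he hle hrow hI hpin n m' => ?_⟩
  obtain ⟨hs1, hs2, hs4⟩ := hthr e he (hle.trans ((min_le_left _ _).trans (min_le_left _ _)))
  have hs6e := hs6 e he (hle.trans ((min_le_left _ _).trans (min_le_right _ _)))
  have h2e : 2 * e ≤ γu := by linarith [hle.trans ((min_le_right _ _).trans (min_le_left _ _))]
  obtain ⟨-, -, -, hgs, -⟩ := hsol e he (hle.trans ((min_le_right _ _).trans (min_le_right _ _)))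
  rw [hgs g hrow hI hpin]
  have hk := abs_iterate_sub_solution_le_uniform hB hC hθ0.le hθ1 hb h2gr htbox htflow hprof he h2e hs1 hs2 hs4 hs6e n m'
  have hmono : 8 * e * (e ^ 2 + 1 / b) * (C * (γu / (1 - θ))) ≤ 8 * (g₁₅ ^ 2 + 1 / b) * (C * (γu / (1 - θ))) * e := by
    have h1 : e ^ 2 ≤ g₁₅ ^ 2 := pow_le_pow_left₀ he.le hle 2
    have hK : 0 ≤ C * (γu / (1 - θ)) := by positivity
    nlinarith [mul_nonneg (mul_nonneg he.le hK) (sub_nonneg.mpr h1)]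
  exact hk.trans (mul_le_mul_of_nonneg_right hmono (by positivity))

end

end Summit.QuantumFields.BalabanUV.Beta.EriceFlowEnclosureB12AsPrintedHistoryContagionShiftFlowPicardRate
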